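import Summits.QuantumFields.YangMills.Theorems.UnitScaleTiltProp7LODSlotK2Member
import Summits.QuantumFields.YangMills.Theorems.UnitScaleTiltProp7ComplementaryProjectorKernelMatrix
import HarnessLib

/-!
# Route `UnitScaleTilt`, crux K1 «MinimiserStabilityRegPr» (stmt-QuantumFields-19200), EX row `hGF[Lift]` (curved member) — **LOD LINE, (L6) SLOT `hK₂`, PIECE (K2b) AT THE MEMBER:
# THE `[R, χ]` FAMILY ROW `Σ_c ‖R(N₂,c y) − N₂,c(R y)‖² ≤ κ_P²‖y‖²` FOR PRINT'S `R = projR (covLapSite U₀) Q″` AT `RegPr`, WITH THE BLOCK-KERNEL LETTERS `βb, hA, hS0, hS1` OF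
# ✓`Prop7LODSlotK2Member.sum_normSq_comm_le_of_kernelBlockBound` (px10 g10, p755622) DISCHARGED BY routeR-w2 g12's B6 ✓`kernelMatrix_blockBound_of_regPr` (p754496) AND B5 §5
# (`sum_const_mul_exp_neg_mul_tdist_le`, `sum_tdist_mul_const_mul_exp_neg_mul_tdist_le`, p754074)** — the `hKP` binder of ✓`Prop7LODSlotK2.hK2_of_rows` (w5 g13, p754590) down to the
# WINDOW∕GAP letters `hδ hwin hgap` of the B-series.

Cell `ym3-torus` (HUMAN RULING D-0037, YM ladder rung R3 — NOT d = 4, NOT infinite volume, NOT a mass gap, NOT Clay).  Width seat `ym-routeR-w4` gen 27 («MINE (K2b) member discharge»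
2026-08-30 03:17:10Z; px10 g11's division (a)(b)(c) 03:09:35Z — this shortens (c)'s displayed list).  THEOREMS ONLY (0 `def`, 0 `sorry`); `--supports stmt-QuantumFields-19200 --as helper`,
count-neutral.  HONEST LABEL (★★OWNER RULING №33 (6)): curved γ-row supplier line, (L6) assembly letters; a KNIT of landed rows — the analysis is in ✓p755622 (IMS first-order core
✓p754058, w5's dictionary ✓p755338, px10∕px17 Lipschitz rows) and in routeR-w2's B-series (Agmon ✓p748812-class, Gram ✓p748771, B4–B6); what stays DISPLAYED is exactly the B-series'
window at slope `μ` (`hδ`, `hwin`) and gap at slope `μ′` (`hgap`) — numeric letters in `a, c₁, μ, μ′, η, L^{K−n}` whose K-uniform satisfiability is the (L6) assembler's §2 and is NOT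
touched here; nothing of (3.49), Thm 3.1∕3.11, `hK₂`, `hT`, `hGF`, EX ∕ 19200 is proved here.

WHAT IS PROVED (ns `Summit.QuantumFields.YangMills.Theorems.Prop7LODSlotK2MemberOfRegPr`).
* ★★★ `hKP_of_regPr` — HYPOTHESIS FORM over routeR-w2's massive variable block VERBATIM (`Q'' hseq ι hι T hT a G hAG hGA`), `n < K`, slopes `0 < μ′ < μ`, B6's window∕gap binders
  `δ₁ hδ₁ hδ hwin hgap` VERBATIM, and ✓p755622's family letters (`χ : J → Site → ℝ` with the univ-form step budget `hfam`, `N₂` with the site reading `hN`):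
  `∀ y, Σ_c ‖R(N₂,c y) − N₂,c(R y)‖² ≤ (2·((L^{K−n})²ℓf2)·S₁² + 8·((d(L^{K−n}−1))²ℓf2)·S₀²)·‖y‖²`, `S₀ = C_β·(2(1+1∕μ′))³`, `S₁ = C_β·(2∕μ′)(2(1+2∕μ′))³`, `C_β` = B6's printed constant
  `(8C_P²√s·e^{3μ})²·((m_B²∕2 − 3ε(μ′)²)⁻¹e^{9μ′})·(4(2(1+1∕(μ−μ′)))³)²` (`βb X Y := C_β·e^{−μ′·tdist(X,Y)}`, symmetric by ✓`tdist_coarse_comm`, `≥ 0` by the gap).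
* ★★★ `hKP_of_regPr'` — the `∃`-FREE reading: `ι`, `T := (ι ∘ₗ Q″)†`, `G` (✓`exists_massive_inverse`) obtained inside; displayed `Q″ + hseq`, `0 < a`, `[Fact (0 < c₁)]`, the slopes, the
  window∕gap letters and the family letters only; ★★ `hKP_sqrt_of_regPr'` — the same with the constant written `(Real.sqrt …)²` (docks by `exact`).
* §3 `hfam_univ_of_off` — adapter `Σ_{c ∈ Zc} ↦ Σ_c` for px17's corner family (clause `hoff`), feeding the univ-form `hfam` of §1∕§2 (and of ✓`hK3_of_readings`).
DOCKING ((L6) assembler): `hKP := hKP_of_regPr' F … χ hfamU N₂c hN₂r` feeds ✓`hK2_of_rows U₀ Q″ ha M N₂ hKD hKP hDst hν` with `κP := Real.sqrt (…)` (`Real.sq_sqrt`; the bracket is `≥ 0`),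
at px17's (L6-χ) family `ℓf2 = 2880∕(L^sL^{K−n})²`: `(L^{K−n})²ℓf2 = 2880∕L^{2s}`, `(d(L^{K−n}−1))²ℓf2 ≤ 25920∕L^{2s}` — K-∕volume-free GIVEN the window∕gap.

References: T. Bałaban, CMP **99** (1985) 389–434 [Balaban1985BackgroundPropagators] ((3.16) p.393, (3.20)–(3.27) pp.394–395, Thm 3.1 (3.46) p.398, (3.49) p.399, (3.100) pp.413–414,
Thm 3.11 p.416); CMP **119** (1988) 243–285 [Balaban1988RG2Cluster] ((2.7) p.13); B. Simon, Ann. IHP A **38** (1983) 295–308 (IMS localisation).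
-/

set_option autoImplicit false

noncomputable section

open scoped BigOperators Matrix.Norms.L2Operator InnerProductSpace ComplexConjugate

namespace Summit.QuantumFields.YangMills.Theorems.Prop7LODSlotK2MemberOfRegPr

open Literature.MathematicalPhysics.QuantumFieldTheory.Balaban1983to89
open Literature.MathematicalPhysics.QuantumFieldTheory.Balaban1983to89.T3ContinuumYM3Torus
open T4Continuum BlockAveraging
open BlockAveraging (Idx)
open B7Prop1Explicit (disp)
open B5Eq118OneStroke (iterBlockOf)
open B10Eq27TorusAxialLog (holT transl)
open B7TransferAnalyticMean (meanCLM)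
open B11Eq103H1Complex (SiteL2K BondL2K projR)
open Summit.QuantumFields.YangMills.Theorems.Prop8Chart (emlIterU)
open T3SectALandauChart (eta eta_pos bgUnits)
open T3PrintedRegularMinimiser (RegPr)
open T3PrintedRegularOrbits (sites_eq)
open T3LevelShift (siteShift)
open Summit.QuantumFields.YangMills.Theorems.Prop7SectET3Transport (periodsT3)
open Summit.QuantumFields.YangMills.Theorems.Prop7SectET3HilbertLetters (W₂ toL2 toL2S DL2 DstarL2 covLapSite)
open Summit.QuantumFields.YangMills.Theorems.Prop7SiteEntryCoordinates (orthonormal_spike top_le_span_spike)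
open Summit.QuantumFields.YangMills.Theorems.Prop7LODSlotK2Member (sum_normSq_comm_le_of_kernelBlockBound)
open Summit.QuantumFields.YangMills.Theorems.Prop7ComplementaryProjectorBlockDecay (kernelMatrix_blockBound_of_regPr sum_const_mul_exp_neg_mul_tdist_le
  sum_tdist_mul_const_mul_exp_neg_mul_tdist_le)
open Summit.QuantumFields.YangMills.Theorems.Prop7BlockDistanceWeights (tdist_coarse_comm)
open Summit.QuantumFields.YangMills.Theorems.Prop7MassivePropagatorCoercive (exists_massive_inverse)

variable (F : T3Family) {n K : ℕ} (h : n ≤ K) {c₀ c₁ : ℝ} [Fact (0 < c₀)] [Fact (0 < c₁)]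
  {ε₀ : ℝ} (hε₀ : 0 < ε₀) (hε7 : 10 ^ 7 * (F.L : ℝ) ^ 3 * ε₀ ≤ 1)
  (U₀ : GaugeField (F.P K) 0 (Matrix.specialUnitaryGroup (Fin 2) ℂ)) (hreg : RegPr F n K ε₀ U₀)
  (Q'' : SiteL2K ℂ 3 (periodsT3 F K) c₀ W₂ →ₗ[ℂ] (Site (F.P K) (K - n) → Matrix (Fin 2) (Fin 2) ℂ))
  (hseq : ∀ lam : Site (F.P K) 0 → Matrix (Fin 2) (Fin 2) ℂ, ∃ ns : (j : ℕ) → Site (F.P K) j → Matrix (Fin 2) (Fin 2) ℂ, ns 0 = lam ∧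
      (∀ (j : ℕ) (y : Site (F.P K) (j + 1)), ns (j + 1) y = ns j (emb y) - meanCLM (Idx (F.P K)) (Matrix (Fin 2) (Fin 2) ℂ) fun i : Idx (F.P K) =>
        ns j (emb y) - ((holT (emlIterU j (bgUnits F K U₀)) (emb y) (stairWord i.2.1 (off i.1)) : (Matrix (Fin 2) (Fin 2) ℂ)ˣ) : Matrix (Fin 2) (Fin 2) ℂ) *
          ns j (transl (emb y) (disp (stairWord i.2.1 (off i.1)))) * (((holT (emlIterU j (bgUnits F K U₀)) (emb y) (stairWord i.2.1 (off i.1)))⁻¹ : (Matrix (Fin 2) (Fin 2) ℂ)ˣ) : Matrix (Fin 2) (Fin 2) ℂ)) ∧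
      ns (K - n) = Q'' (toL2S F K c₀ lam))
  (ι : (Site (F.P K) (K - n) → Matrix (Fin 2) (Fin 2) ℂ) →ₗ[ℂ] SiteL2K ℂ 3 (periodsT3 F n) c₁ W₂)
  (hι : ∀ c, ι c = toL2S F n c₁ (fun z => c (siteShift (sites_eq F n K h) z)))
  (T : SiteL2K ℂ 3 (periodsT3 F n) c₁ W₂ →ₗ[ℂ] SiteL2K ℂ 3 (periodsT3 F K) c₀ W₂)
  (hT : ∀ (l : SiteL2K ℂ 3 (periodsT3 F K) c₀ W₂) (f : SiteL2K ℂ 3 (periodsT3 F n) c₁ W₂), ⟪ι (Q'' l), f⟫_ℂ = ⟪l, T f⟫_ℂ)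
  {a : ℝ} (ha : 0 < a)
  (G : SiteL2K ℂ 3 (periodsT3 F K) c₀ W₂ →ₗ[ℂ] SiteL2K ℂ 3 (periodsT3 F K) c₀ W₂)
  (hAG : ∀ f, covLapSite F n K c₀ U₀ (G f) + (a : ℂ) • T (ι (Q'' (G f))) = f)
  (hGA : ∀ u, G (covLapSite F n K c₀ U₀ u + (a : ℂ) • T (ι (Q'' u))) = u)

/-! ## §1 Hypothesis form: routeR-w2's massive variable block, B6's window∕gap, ✓p755622's family letters -/

include hε₀ hε7 hreg hseq hι hT ha hAG hGA in
/-- ★★★ **(K2b) AT THE MEMBER — THE `[R, χ]` FAMILY ROW WITH THE BLOCK-KERNEL LETTERS DISCHARGED.**  For `n < K`, `U₀ ∈ 𝔘_k(ε₀)` (`10⁷L³ε₀ ≤ 1`), the massive data `Q″ ι T a G`,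
slopes `0 < μ′ < μ` with the window at `μ` (`hδ`, `hwin`) and the gap at `μ′` (`hgap`) of ✓`kernelMatrix_blockBound_of_regPr`, any finite real family `χ_c` with the univ-form step budget
`Σ_c (χ_c(x+e_ν) − χ_c x)² ≤ ℓ_f²` and linear `N₂,c` with the site reading `hN`:
**`∀ y, Σ_c ‖R(N₂,c y) − N₂,c(R y)‖² ≤ (2·((L^{K−n})²ℓ_f²)·S₁² + 8·((d(L^{K−n}−1))²ℓ_f²)·S₀²)·‖y‖²`**, `R = projR (covLapSite U₀) Q″`, `S₀ = C_β(2(1+1∕μ′))³`, `S₁ = C_β(2∕μ′)(2(1+2∕μ′))³`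
— ✓`sum_normSq_comm_le_of_kernelBlockBound` at `βb X Y := C_β·e^{−μ′·tdist(X,Y)}` with `hA` := ✓`kernelMatrix_blockBound_of_regPr`, `hS0`∕`hS1` := B5 §5.  (= ✓`hK2_of_rows`'s `hKP` with
`κP := √(…)`.) [cite: Balaban1985BackgroundPropagators, Thm 3.1 (3.46) p.398, (3.49) p.399, (3.100) pp.413–414, Thm 3.11 p.416; Balaban1988RG2Cluster, (2.7) p.13] -/
theorem hKP_of_regPr (hnK : n < K) {μ μ' : ℝ} (hμ' : 0 < μ') (hμμ' : μ' < μ)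
    {δ₁ : ℝ} (hδ₁ : 0 ≤ δ₁)
    (hδ : 3 * ((eta F n K)⁻¹) ^ 2 * (Real.exp (μ * eta F n K) - 1) ^ 2 + a * ((25 / 8) * (c₁ * ((((F.P K).L : ℝ) ^ (F.P K).d) ^ (K - n))⁻¹ / c₀)) * (Real.exp (3 * μ) - 1) ^ 2 ≤ δ₁ ^ 2)
    (hwin : Real.sqrt (max 2 (16 * c₀ * ((F.L : ℝ) ^ (K - n)) ^ 3 / (a * c₁))) * δ₁ ≤ 1 / 10)
    (hgap : 3 * ((Real.sqrt (max 2 (16 * c₀ * ((F.L : ℝ) ^ (K - n)) ^ 3 / (a * c₁))) * (2 + Real.sqrt (max 2 (16 * c₀ * ((F.L : ℝ) ^ (K - n)) ^ 3 / (a * c₁))))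
          * (Real.sqrt 3 * (eta F n K)⁻¹ * (Real.exp (μ' * eta F n K) - 1) + (Real.sqrt 3 * (eta F n K)⁻¹ * (Real.exp (μ' * eta F n K) - 1)) ^ 2 + Real.sqrt a * (Real.sqrt ((25 / 8) * (c₁ * ((((F.P K).L : ℝ) ^ (F.P K).d) ^ (K - n))⁻¹ / c₀))) * (Real.exp (3 * μ') - 1) + a * (Real.sqrt ((25 / 8) * (c₁ * ((((F.P K).L : ℝ) ^ (F.P K).d) ^ (K - n))⁻¹ / c₀))) ^ 2 * (Real.exp (3 * μ') - 1) ^ 2)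
          * (8 * Real.sqrt (max 2 (16 * c₀ * ((F.L : ℝ) ^ (K - n)) ^ 3 / (a * c₁))) + 8 * Real.sqrt (max 2 (16 * c₀ * ((F.L : ℝ) ^ (K - n)) ^ 3 / (a * c₁))) ^ 2)
          * ((Real.sqrt ((25 / 8) * (c₁ * ((((F.P K).L : ℝ) ^ (F.P K).d) ^ (K - n))⁻¹ / c₀))) * (1 + (Real.exp (3 * μ') - 1))) + (max 2 (16 * c₀ * ((F.L : ℝ) ^ (K - n)) ^ 3 / (a * c₁))) * ((Real.sqrt ((25 / 8) * (c₁ * ((((F.P K).L : ℝ) ^ (F.P K).d) ^ (K - n))⁻¹ / c₀))) * (Real.exp (3 * μ') - 1)))) ^ 2 < (2 / ((1 + (25 / 8) * (c₁ * ((((F.P K).L : ℝ) ^ (F.P K).d) ^ (K - n))⁻¹ / c₀)) * (600 * (27 / 4 : ℝ) ^ 6 * (c₀ * ((F.L : ℝ) ^ 3) ^ (K - n) / c₁) + a))) ^ 2 / 2)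
    {J : Type*} [Fintype J] (χ : J → Site (F.P K) 0 → ℝ) {ℓf2 : ℝ}
    (hfam : ∀ (x : Site (F.P K) 0) (ν : Fin (F.P K).d), ∑ c, (χ c (x.shift ν) - χ c x) ^ 2 ≤ ℓf2)
    (N₂ : J → (SiteL2K ℂ 3 (periodsT3 F K) c₀ W₂ →ₗ[ℂ] SiteL2K ℂ 3 (periodsT3 F K) c₀ W₂))
    (hN : ∀ (c : J) (φ : SiteL2K ℂ 3 (periodsT3 F K) c₀ W₂) (x : Site (F.P K) 0), (toL2S F K c₀).symm (N₂ c φ) x = χ c x • (toL2S F K c₀).symm φ x) :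
    ∀ y : SiteL2K ℂ 3 (periodsT3 F K) c₀ W₂,
      ∑ c, ‖projR (covLapSite F n K c₀ U₀) Q'' (N₂ c y) - N₂ c (projR (covLapSite F n K c₀ U₀) Q'' y)‖ ^ 2
        ≤ (2 * (((F.L : ℝ) ^ (K - n)) ^ 2 * ℓf2) * ((8 * (max 2 (16 * c₀ * ((F.L : ℝ) ^ (K - n)) ^ 3 / (a * c₁))) * Real.sqrt ((25 / 8) * (c₁ * ((((F.P K).L : ℝ) ^ (F.P K).d) ^ (K - n))⁻¹ / c₀)) * Real.exp (3 * μ)) ^ 2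
          * (((2 / ((1 + (25 / 8) * (c₁ * ((((F.P K).L : ℝ) ^ (F.P K).d) ^ (K - n))⁻¹ / c₀)) * (600 * (27 / 4 : ℝ) ^ 6 * (c₀ * ((F.L : ℝ) ^ 3) ^ (K - n) / c₁) + a))) ^ 2 / 2 - 3 * ((Real.sqrt (max 2 (16 * c₀ * ((F.L : ℝ) ^ (K - n)) ^ 3 / (a * c₁))) * (2 + Real.sqrt (max 2 (16 * c₀ * ((F.L : ℝ) ^ (K - n)) ^ 3 / (a * c₁))))
          * (Real.sqrt 3 * (eta F n K)⁻¹ * (Real.exp (μ' * eta F n K) - 1) + (Real.sqrt 3 * (eta F n K)⁻¹ * (Real.exp (μ' * eta F n K) - 1)) ^ 2 + Real.sqrt a * (Real.sqrt ((25 / 8) * (c₁ * ((((F.P K).L : ℝ) ^ (F.P K).d) ^ (K - n))⁻¹ / c₀))) * (Real.exp (3 * μ') - 1) + a * (Real.sqrt ((25 / 8) * (c₁ * ((((F.P K).L : ℝ) ^ (F.P K).d) ^ (K - n))⁻¹ / c₀))) ^ 2 * (Real.exp (3 * μ') - 1) ^ 2)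
          * (8 * Real.sqrt (max 2 (16 * c₀ * ((F.L : ℝ) ^ (K - n)) ^ 3 / (a * c₁))) + 8 * Real.sqrt (max 2 (16 * c₀ * ((F.L : ℝ) ^ (K - n)) ^ 3 / (a * c₁))) ^ 2)
          * ((Real.sqrt ((25 / 8) * (c₁ * ((((F.P K).L : ℝ) ^ (F.P K).d) ^ (K - n))⁻¹ / c₀))) * (1 + (Real.exp (3 * μ') - 1))) + (max 2 (16 * c₀ * ((F.L : ℝ) ^ (K - n)) ^ 3 / (a * c₁))) * ((Real.sqrt ((25 / 8) * (c₁ * ((((F.P K).L : ℝ) ^ (F.P K).d) ^ (K - n))⁻¹ / c₀))) * (Real.exp (3 * μ') - 1)))) ^ 2)⁻¹ * Real.exp (9 * μ'))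
          * (4 * (2 * (1 + 1 / (μ - μ'))) ^ 3) ^ 2
          * ((2 / μ') * (2 * (1 + 1 / (μ' / 2))) ^ 3)) ^ 2
            + 8 * ((((F.P K).d : ℝ) * ((F.L : ℝ) ^ (K - n) - 1)) ^ 2 * ℓf2) * ((8 * (max 2 (16 * c₀ * ((F.L : ℝ) ^ (K - n)) ^ 3 / (a * c₁))) * Real.sqrt ((25 / 8) * (c₁ * ((((F.P K).L : ℝ) ^ (F.P K).d) ^ (K - n))⁻¹ / c₀)) * Real.exp (3 * μ)) ^ 2
          * (((2 / ((1 + (25 / 8) * (c₁ * ((((F.P K).L : ℝ) ^ (F.P K).d) ^ (K - n))⁻¹ / c₀)) * (600 * (27 / 4 : ℝ) ^ 6 * (c₀ * ((F.L : ℝ) ^ 3) ^ (K - n) / c₁) + a))) ^ 2 / 2 - 3 * ((Real.sqrt (max 2 (16 * c₀ * ((F.L : ℝ) ^ (K - n)) ^ 3 / (a * c₁))) * (2 + Real.sqrt (max 2 (16 * c₀ * ((F.L : ℝ) ^ (K - n)) ^ 3 / (a * c₁))))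
          * (Real.sqrt 3 * (eta F n K)⁻¹ * (Real.exp (μ' * eta F n K) - 1) + (Real.sqrt 3 * (eta F n K)⁻¹ * (Real.exp (μ' * eta F n K) - 1)) ^ 2 + Real.sqrt a * (Real.sqrt ((25 / 8) * (c₁ * ((((F.P K).L : ℝ) ^ (F.P K).d) ^ (K - n))⁻¹ / c₀))) * (Real.exp (3 * μ') - 1) + a * (Real.sqrt ((25 / 8) * (c₁ * ((((F.P K).L : ℝ) ^ (F.P K).d) ^ (K - n))⁻¹ / c₀))) ^ 2 * (Real.exp (3 * μ') - 1) ^ 2)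
          * (8 * Real.sqrt (max 2 (16 * c₀ * ((F.L : ℝ) ^ (K - n)) ^ 3 / (a * c₁))) + 8 * Real.sqrt (max 2 (16 * c₀ * ((F.L : ℝ) ^ (K - n)) ^ 3 / (a * c₁))) ^ 2)
          * ((Real.sqrt ((25 / 8) * (c₁ * ((((F.P K).L : ℝ) ^ (F.P K).d) ^ (K - n))⁻¹ / c₀))) * (1 + (Real.exp (3 * μ') - 1))) + (max 2 (16 * c₀ * ((F.L : ℝ) ^ (K - n)) ^ 3 / (a * c₁))) * ((Real.sqrt ((25 / 8) * (c₁ * ((((F.P K).L : ℝ) ^ (F.P K).d) ^ (K - n))⁻¹ / c₀))) * (Real.exp (3 * μ') - 1)))) ^ 2)⁻¹ * Real.exp (9 * μ'))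
          * (4 * (2 * (1 + 1 / (μ - μ'))) ^ 3) ^ 2
          * (2 * (1 + 1 / μ')) ^ 3) ^ 2) * ‖y‖ ^ 2 := by
  -- the gap makes B6's constant non-negative
  have hgap' := sub_pos.2 hgap
  have hC : (0 : ℝ) ≤ (8 * (max 2 (16 * c₀ * ((F.L : ℝ) ^ (K - n)) ^ 3 / (a * c₁))) * Real.sqrt ((25 / 8) * (c₁ * ((((F.P K).L : ℝ) ^ (F.P K).d) ^ (K - n))⁻¹ / c₀)) * Real.exp (3 * μ)) ^ 2
          * (((2 / ((1 + (25 / 8) * (c₁ * ((((F.P K).L : ℝ) ^ (F.P K).d) ^ (K - n))⁻¹ / c₀)) * (600 * (27 / 4 : ℝ) ^ 6 * (c₀ * ((F.L : ℝ) ^ 3) ^ (K - n) / c₁) + a))) ^ 2 / 2 - 3 * ((Real.sqrt (max 2 (16 * c₀ * ((F.L : ℝ) ^ (K - n)) ^ 3 / (a * c₁))) * (2 + Real.sqrt (max 2 (16 * c₀ * ((F.L : ℝ) ^ (K - n)) ^ 3 / (a * c₁))))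
          * (Real.sqrt 3 * (eta F n K)⁻¹ * (Real.exp (μ' * eta F n K) - 1) + (Real.sqrt 3 * (eta F n K)⁻¹ * (Real.exp (μ' * eta F n K) - 1)) ^ 2 + Real.sqrt a * (Real.sqrt ((25 / 8) * (c₁ * ((((F.P K).L : ℝ) ^ (F.P K).d) ^ (K - n))⁻¹ / c₀))) * (Real.exp (3 * μ') - 1) + a * (Real.sqrt ((25 / 8) * (c₁ * ((((F.P K).L : ℝ) ^ (F.P K).d) ^ (K - n))⁻¹ / c₀))) ^ 2 * (Real.exp (3 * μ') - 1) ^ 2)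
          * (8 * Real.sqrt (max 2 (16 * c₀ * ((F.L : ℝ) ^ (K - n)) ^ 3 / (a * c₁))) + 8 * Real.sqrt (max 2 (16 * c₀ * ((F.L : ℝ) ^ (K - n)) ^ 3 / (a * c₁))) ^ 2)
          * ((Real.sqrt ((25 / 8) * (c₁ * ((((F.P K).L : ℝ) ^ (F.P K).d) ^ (K - n))⁻¹ / c₀))) * (1 + (Real.exp (3 * μ') - 1))) + (max 2 (16 * c₀ * ((F.L : ℝ) ^ (K - n)) ^ 3 / (a * c₁))) * ((Real.sqrt ((25 / 8) * (c₁ * ((((F.P K).L : ℝ) ^ (F.P K).d) ^ (K - n))⁻¹ / c₀))) * (Real.exp (3 * μ') - 1)))) ^ 2)⁻¹ * Real.exp (9 * μ'))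
          * (4 * (2 * (1 + 1 / (μ - μ'))) ^ 3) ^ 2 :=
    mul_nonneg (mul_nonneg (sq_nonneg _) (mul_nonneg (inv_pos.2 hgap').le (Real.exp_pos _).le)) (sq_nonneg _)
  refine sum_normSq_comm_le_of_kernelBlockBound F n K c₀ (projR (covLapSite F n K c₀ U₀) Q'')
    (fun X Y => (8 * (max 2 (16 * c₀ * ((F.L : ℝ) ^ (K - n)) ^ 3 / (a * c₁))) * Real.sqrt ((25 / 8) * (c₁ * ((((F.P K).L : ℝ) ^ (F.P K).d) ^ (K - n))⁻¹ / c₀)) * Real.exp (3 * μ)) ^ 2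
          * (((2 / ((1 + (25 / 8) * (c₁ * ((((F.P K).L : ℝ) ^ (F.P K).d) ^ (K - n))⁻¹ / c₀)) * (600 * (27 / 4 : ℝ) ^ 6 * (c₀ * ((F.L : ℝ) ^ 3) ^ (K - n) / c₁) + a))) ^ 2 / 2 - 3 * ((Real.sqrt (max 2 (16 * c₀ * ((F.L : ℝ) ^ (K - n)) ^ 3 / (a * c₁))) * (2 + Real.sqrt (max 2 (16 * c₀ * ((F.L : ℝ) ^ (K - n)) ^ 3 / (a * c₁))))
          * (Real.sqrt 3 * (eta F n K)⁻¹ * (Real.exp (μ' * eta F n K) - 1) + (Real.sqrt 3 * (eta F n K)⁻¹ * (Real.exp (μ' * eta F n K) - 1)) ^ 2 + Real.sqrt a * (Real.sqrt ((25 / 8) * (c₁ * ((((F.P K).L : ℝ) ^ (F.P K).d) ^ (K - n))⁻¹ / c₀))) * (Real.exp (3 * μ') - 1) + a * (Real.sqrt ((25 / 8) * (c₁ * ((((F.P K).L : ℝ) ^ (F.P K).d) ^ (K - n))⁻¹ / c₀))) ^ 2 * (Real.exp (3 * μ') - 1) ^ 2)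
          * (8 * Real.sqrt (max 2 (16 * c₀ * ((F.L : ℝ) ^ (K - n)) ^ 3 / (a * c₁))) + 8 * Real.sqrt (max 2 (16 * c₀ * ((F.L : ℝ) ^ (K - n)) ^ 3 / (a * c₁))) ^ 2)
          * ((Real.sqrt ((25 / 8) * (c₁ * ((((F.P K).L : ℝ) ^ (F.P K).d) ^ (K - n))⁻¹ / c₀))) * (1 + (Real.exp (3 * μ') - 1))) + (max 2 (16 * c₀ * ((F.L : ℝ) ^ (K - n)) ^ 3 / (a * c₁))) * ((Real.sqrt ((25 / 8) * (c₁ * ((((F.P K).L : ℝ) ^ (F.P K).d) ^ (K - n))⁻¹ / c₀))) * (Real.exp (3 * μ') - 1)))) ^ 2)⁻¹ * Real.exp (9 * μ'))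
          * (4 * (2 * (1 + 1 / (μ - μ'))) ^ 3) ^ 2
          * Real.exp (-(μ' * (Site.tdist (P := F.P K) X Y : ℝ))))
    (fun X Y => by simp only [tdist_coarse_comm F X Y]) (fun X Y => mul_nonneg hC (Real.exp_pos _).le)
    (mul_nonneg hC (by positivity)) (mul_nonneg hC (by positivity))
    (fun X Y u w => kernelMatrix_blockBound_of_regPr F h hε₀ hε7 U₀ hreg Q'' hseq ι hι T hT ha G hAG hGA hnK hμ'.le hμμ' hδ₁ hδ hwin hgap X Y u w)
    (fun X => sum_const_mul_exp_neg_mul_tdist_le F hμ' hC X) (fun X => sum_tdist_mul_const_mul_exp_neg_mul_tdist_le F hμ' hC X)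
    χ hfam N₂ hN

/-! ## §2 The `∃`-free reading -/

include hε₀ hε7 hreg hseq ha in
/-- ★★★ **(K2b) AT THE MEMBER, `∃`-FREE** (what the (L6) assembler wants when no massive data is in scope): as §1, with the coarse reading `ι := toL2S ∘ (· ∘ siteShift)`, the adjoint
`T := (ι ∘ₗ Q″)†` and the massive inverse `G` (✓`exists_massive_inverse`) obtained inside — displayed: `Q″ + hseq` (clause (iv)), `0 < a`, the coarse weight `c₁` (`[Fact (0 < c₁)]`), the
slopes, the window∕gap letters, the family letters. [cite: Balaban1985BackgroundPropagators, (3.16) p.393, Thm 3.1 (3.46) p.398, (3.49) p.399, Thm 3.11 p.416; Balaban1988RG2Cluster, (2.7) p.13] -/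
theorem hKP_of_regPr' (hnK : n < K) {μ μ' : ℝ} (hμ' : 0 < μ') (hμμ' : μ' < μ)
    {δ₁ : ℝ} (hδ₁ : 0 ≤ δ₁)
    (hδ : 3 * ((eta F n K)⁻¹) ^ 2 * (Real.exp (μ * eta F n K) - 1) ^ 2 + a * ((25 / 8) * (c₁ * ((((F.P K).L : ℝ) ^ (F.P K).d) ^ (K - n))⁻¹ / c₀)) * (Real.exp (3 * μ) - 1) ^ 2 ≤ δ₁ ^ 2)
    (hwin : Real.sqrt (max 2 (16 * c₀ * ((F.L : ℝ) ^ (K - n)) ^ 3 / (a * c₁))) * δ₁ ≤ 1 / 10)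
    (hgap : 3 * ((Real.sqrt (max 2 (16 * c₀ * ((F.L : ℝ) ^ (K - n)) ^ 3 / (a * c₁))) * (2 + Real.sqrt (max 2 (16 * c₀ * ((F.L : ℝ) ^ (K - n)) ^ 3 / (a * c₁))))
          * (Real.sqrt 3 * (eta F n K)⁻¹ * (Real.exp (μ' * eta F n K) - 1) + (Real.sqrt 3 * (eta F n K)⁻¹ * (Real.exp (μ' * eta F n K) - 1)) ^ 2 + Real.sqrt a * (Real.sqrt ((25 / 8) * (c₁ * ((((F.P K).L : ℝ) ^ (F.P K).d) ^ (K - n))⁻¹ / c₀))) * (Real.exp (3 * μ') - 1) + a * (Real.sqrt ((25 / 8) * (c₁ * ((((F.P K).L : ℝ) ^ (F.P K).d) ^ (K - n))⁻¹ / c₀))) ^ 2 * (Real.exp (3 * μ') - 1) ^ 2)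
          * (8 * Real.sqrt (max 2 (16 * c₀ * ((F.L : ℝ) ^ (K - n)) ^ 3 / (a * c₁))) + 8 * Real.sqrt (max 2 (16 * c₀ * ((F.L : ℝ) ^ (K - n)) ^ 3 / (a * c₁))) ^ 2)
          * ((Real.sqrt ((25 / 8) * (c₁ * ((((F.P K).L : ℝ) ^ (F.P K).d) ^ (K - n))⁻¹ / c₀))) * (1 + (Real.exp (3 * μ') - 1))) + (max 2 (16 * c₀ * ((F.L : ℝ) ^ (K - n)) ^ 3 / (a * c₁))) * ((Real.sqrt ((25 / 8) * (c₁ * ((((F.P K).L : ℝ) ^ (F.P K).d) ^ (K - n))⁻¹ / c₀))) * (Real.exp (3 * μ') - 1)))) ^ 2 < (2 / ((1 + (25 / 8) * (c₁ * ((((F.P K).L : ℝ) ^ (F.P K).d) ^ (K - n))⁻¹ / c₀)) * (600 * (27 / 4 : ℝ) ^ 6 * (c₀ * ((F.L : ℝ) ^ 3) ^ (K - n) / c₁) + a))) ^ 2 / 2)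
    {J : Type*} [Fintype J] (χ : J → Site (F.P K) 0 → ℝ) {ℓf2 : ℝ}
    (hfam : ∀ (x : Site (F.P K) 0) (ν : Fin (F.P K).d), ∑ c, (χ c (x.shift ν) - χ c x) ^ 2 ≤ ℓf2)
    (N₂ : J → (SiteL2K ℂ 3 (periodsT3 F K) c₀ W₂ →ₗ[ℂ] SiteL2K ℂ 3 (periodsT3 F K) c₀ W₂))
    (hN : ∀ (c : J) (φ : SiteL2K ℂ 3 (periodsT3 F K) c₀ W₂) (x : Site (F.P K) 0), (toL2S F K c₀).symm (N₂ c φ) x = χ c x • (toL2S F K c₀).symm φ x) :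
    ∀ y : SiteL2K ℂ 3 (periodsT3 F K) c₀ W₂,
      ∑ c, ‖projR (covLapSite F n K c₀ U₀) Q'' (N₂ c y) - N₂ c (projR (covLapSite F n K c₀ U₀) Q'' y)‖ ^ 2
        ≤ (2 * (((F.L : ℝ) ^ (K - n)) ^ 2 * ℓf2) * ((8 * (max 2 (16 * c₀ * ((F.L : ℝ) ^ (K - n)) ^ 3 / (a * c₁))) * Real.sqrt ((25 / 8) * (c₁ * ((((F.P K).L : ℝ) ^ (F.P K).d) ^ (K - n))⁻¹ / c₀)) * Real.exp (3 * μ)) ^ 2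
          * (((2 / ((1 + (25 / 8) * (c₁ * ((((F.P K).L : ℝ) ^ (F.P K).d) ^ (K - n))⁻¹ / c₀)) * (600 * (27 / 4 : ℝ) ^ 6 * (c₀ * ((F.L : ℝ) ^ 3) ^ (K - n) / c₁) + a))) ^ 2 / 2 - 3 * ((Real.sqrt (max 2 (16 * c₀ * ((F.L : ℝ) ^ (K - n)) ^ 3 / (a * c₁))) * (2 + Real.sqrt (max 2 (16 * c₀ * ((F.L : ℝ) ^ (K - n)) ^ 3 / (a * c₁))))
          * (Real.sqrt 3 * (eta F n K)⁻¹ * (Real.exp (μ' * eta F n K) - 1) + (Real.sqrt 3 * (eta F n K)⁻¹ * (Real.exp (μ' * eta F n K) - 1)) ^ 2 + Real.sqrt a * (Real.sqrt ((25 / 8) * (c₁ * ((((F.P K).L : ℝ) ^ (F.P K).d) ^ (K - n))⁻¹ / c₀))) * (Real.exp (3 * μ') - 1) + a * (Real.sqrt ((25 / 8) * (c₁ * ((((F.P K).L : ℝ) ^ (F.P K).d) ^ (K - n))⁻¹ / c₀))) ^ 2 * (Real.exp (3 * μ') - 1) ^ 2)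
          * (8 * Real.sqrt (max 2 (16 * c₀ * ((F.L : ℝ) ^ (K - n)) ^ 3 / (a * c₁))) + 8 * Real.sqrt (max 2 (16 * c₀ * ((F.L : ℝ) ^ (K - n)) ^ 3 / (a * c₁))) ^ 2)
          * ((Real.sqrt ((25 / 8) * (c₁ * ((((F.P K).L : ℝ) ^ (F.P K).d) ^ (K - n))⁻¹ / c₀))) * (1 + (Real.exp (3 * μ') - 1))) + (max 2 (16 * c₀ * ((F.L : ℝ) ^ (K - n)) ^ 3 / (a * c₁))) * ((Real.sqrt ((25 / 8) * (c₁ * ((((F.P K).L : ℝ) ^ (F.P K).d) ^ (K - n))⁻¹ / c₀))) * (Real.exp (3 * μ') - 1)))) ^ 2)⁻¹ * Real.exp (9 * μ'))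
          * (4 * (2 * (1 + 1 / (μ - μ'))) ^ 3) ^ 2
          * ((2 / μ') * (2 * (1 + 1 / (μ' / 2))) ^ 3)) ^ 2
            + 8 * ((((F.P K).d : ℝ) * ((F.L : ℝ) ^ (K - n) - 1)) ^ 2 * ℓf2) * ((8 * (max 2 (16 * c₀ * ((F.L : ℝ) ^ (K - n)) ^ 3 / (a * c₁))) * Real.sqrt ((25 / 8) * (c₁ * ((((F.P K).L : ℝ) ^ (F.P K).d) ^ (K - n))⁻¹ / c₀)) * Real.exp (3 * μ)) ^ 2
          * (((2 / ((1 + (25 / 8) * (c₁ * ((((F.P K).L : ℝ) ^ (F.P K).d) ^ (K - n))⁻¹ / c₀)) * (600 * (27 / 4 : ℝ) ^ 6 * (c₀ * ((F.L : ℝ) ^ 3) ^ (K - n) / c₁) + a))) ^ 2 / 2 - 3 * ((Real.sqrt (max 2 (16 * c₀ * ((F.L : ℝ) ^ (K - n)) ^ 3 / (a * c₁))) * (2 + Real.sqrt (max 2 (16 * c₀ * ((F.L : ℝ) ^ (K - n)) ^ 3 / (a * c₁))))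
          * (Real.sqrt 3 * (eta F n K)⁻¹ * (Real.exp (μ' * eta F n K) - 1) + (Real.sqrt 3 * (eta F n K)⁻¹ * (Real.exp (μ' * eta F n K) - 1)) ^ 2 + Real.sqrt a * (Real.sqrt ((25 / 8) * (c₁ * ((((F.P K).L : ℝ) ^ (F.P K).d) ^ (K - n))⁻¹ / c₀))) * (Real.exp (3 * μ') - 1) + a * (Real.sqrt ((25 / 8) * (c₁ * ((((F.P K).L : ℝ) ^ (F.P K).d) ^ (K - n))⁻¹ / c₀))) ^ 2 * (Real.exp (3 * μ') - 1) ^ 2)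
          * (8 * Real.sqrt (max 2 (16 * c₀ * ((F.L : ℝ) ^ (K - n)) ^ 3 / (a * c₁))) + 8 * Real.sqrt (max 2 (16 * c₀ * ((F.L : ℝ) ^ (K - n)) ^ 3 / (a * c₁))) ^ 2)
          * ((Real.sqrt ((25 / 8) * (c₁ * ((((F.P K).L : ℝ) ^ (F.P K).d) ^ (K - n))⁻¹ / c₀))) * (1 + (Real.exp (3 * μ') - 1))) + (max 2 (16 * c₀ * ((F.L : ℝ) ^ (K - n)) ^ 3 / (a * c₁))) * ((Real.sqrt ((25 / 8) * (c₁ * ((((F.P K).L : ℝ) ^ (F.P K).d) ^ (K - n))⁻¹ / c₀))) * (Real.exp (3 * μ') - 1)))) ^ 2)⁻¹ * Real.exp (9 * μ'))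
          * (4 * (2 * (1 + 1 / (μ - μ'))) ^ 3) ^ 2
          * (2 * (1 + 1 / μ')) ^ 3) ^ 2) * ‖y‖ ^ 2 := by
  -- the coarse reading `ι`, as a linear map
  obtain ⟨ι', hι'⟩ : ∃ ι' : (Site (F.P K) (K - n) → Matrix (Fin 2) (Fin 2) ℂ) →ₗ[ℂ] SiteL2K ℂ 3 (periodsT3 F n) c₁ W₂,
      ∀ c, ι' c = toL2S F n c₁ (fun z => c (siteShift (sites_eq F n K hnK.le) z)) :=
    ⟨(toL2S F n c₁).toLinearMap ∘ₗ LinearMap.funLeft ℂ (Matrix (Fin 2) (Fin 2) ℂ) (siteShift (sites_eq F n K hnK.le)), fun c => rfl⟩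
  -- the adjoint of `ι ∘ Q″` (finite dimension)
  obtain ⟨T', hT'⟩ : ∃ T' : SiteL2K ℂ 3 (periodsT3 F n) c₁ W₂ →ₗ[ℂ] SiteL2K ℂ 3 (periodsT3 F K) c₀ W₂,
      ∀ (l : SiteL2K ℂ 3 (periodsT3 F K) c₀ W₂) (f : SiteL2K ℂ 3 (periodsT3 F n) c₁ W₂), ⟪ι' (Q'' l), f⟫_ℂ = ⟪l, T' f⟫_ℂ :=
    ⟨LinearMap.adjoint (ι' ∘ₗ Q''), fun l f => by rw [LinearMap.adjoint_inner_right, LinearMap.comp_apply]⟩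
  -- the massive inverse
  obtain ⟨G', hAG', hGA', -⟩ := exists_massive_inverse F hnK.le hε₀ hε7 U₀ hreg Q'' hseq ι' hι' T' hT' ha
  exact hKP_of_regPr F hnK.le hε₀ hε7 U₀ hreg Q'' hseq ι' hι' T' hT' ha G' hAG' hGA' hnK hμ' hμμ' hδ₁ hδ hwin hgap χ hfam N₂ hN

include hε₀ hε7 hreg hseq ha in
/-- ★★ **THE SAME IN `κP ^ 2` LETTERS** (docks into ✓`hK2_of_rows`'s `hKP : ∀ y, Σ_c ‖…‖² ≤ κP ^ 2 * ‖y‖²` by `exact`, `κP := Real.sqrt (…)`): the bracket of §2 is `≥ 0`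
(`ℓf2 ≥ 0` from `hfam` at one site), so `(Real.sqrt bracket)² = bracket`. [cite: Balaban1985BackgroundPropagators, (3.49) p.399, Thm 3.11 p.416] -/
theorem hKP_sqrt_of_regPr' (hnK : n < K) {μ μ' : ℝ} (hμ' : 0 < μ') (hμμ' : μ' < μ)
    {δ₁ : ℝ} (hδ₁ : 0 ≤ δ₁)
    (hδ : 3 * ((eta F n K)⁻¹) ^ 2 * (Real.exp (μ * eta F n K) - 1) ^ 2 + a * ((25 / 8) * (c₁ * ((((F.P K).L : ℝ) ^ (F.P K).d) ^ (K - n))⁻¹ / c₀)) * (Real.exp (3 * μ) - 1) ^ 2 ≤ δ₁ ^ 2)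
    (hwin : Real.sqrt (max 2 (16 * c₀ * ((F.L : ℝ) ^ (K - n)) ^ 3 / (a * c₁))) * δ₁ ≤ 1 / 10)
    (hgap : 3 * ((Real.sqrt (max 2 (16 * c₀ * ((F.L : ℝ) ^ (K - n)) ^ 3 / (a * c₁))) * (2 + Real.sqrt (max 2 (16 * c₀ * ((F.L : ℝ) ^ (K - n)) ^ 3 / (a * c₁))))
          * (Real.sqrt 3 * (eta F n K)⁻¹ * (Real.exp (μ' * eta F n K) - 1) + (Real.sqrt 3 * (eta F n K)⁻¹ * (Real.exp (μ' * eta F n K) - 1)) ^ 2 + Real.sqrt a * (Real.sqrt ((25 / 8) * (c₁ * ((((F.P K).L : ℝ) ^ (F.P K).d) ^ (K - n))⁻¹ / c₀))) * (Real.exp (3 * μ') - 1) + a * (Real.sqrt ((25 / 8) * (c₁ * ((((F.P K).L : ℝ) ^ (F.P K).d) ^ (K - n))⁻¹ / c₀))) ^ 2 * (Real.exp (3 * μ') - 1) ^ 2)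
          * (8 * Real.sqrt (max 2 (16 * c₀ * ((F.L : ℝ) ^ (K - n)) ^ 3 / (a * c₁))) + 8 * Real.sqrt (max 2 (16 * c₀ * ((F.L : ℝ) ^ (K - n)) ^ 3 / (a * c₁))) ^ 2)
          * ((Real.sqrt ((25 / 8) * (c₁ * ((((F.P K).L : ℝ) ^ (F.P K).d) ^ (K - n))⁻¹ / c₀))) * (1 + (Real.exp (3 * μ') - 1))) + (max 2 (16 * c₀ * ((F.L : ℝ) ^ (K - n)) ^ 3 / (a * c₁))) * ((Real.sqrt ((25 / 8) * (c₁ * ((((F.P K).L : ℝ) ^ (F.P K).d) ^ (K - n))⁻¹ / c₀))) * (Real.exp (3 * μ') - 1)))) ^ 2 < (2 / ((1 + (25 / 8) * (c₁ * ((((F.P K).L : ℝ) ^ (F.P K).d) ^ (K - n))⁻¹ / c₀)) * (600 * (27 / 4 : ℝ) ^ 6 * (c₀ * ((F.L : ℝ) ^ 3) ^ (K - n) / c₁) + a))) ^ 2 / 2)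
    {J : Type*} [Fintype J] (χ : J → Site (F.P K) 0 → ℝ) {ℓf2 : ℝ}
    (hfam : ∀ (x : Site (F.P K) 0) (ν : Fin (F.P K).d), ∑ c, (χ c (x.shift ν) - χ c x) ^ 2 ≤ ℓf2)
    (N₂ : J → (SiteL2K ℂ 3 (periodsT3 F K) c₀ W₂ →ₗ[ℂ] SiteL2K ℂ 3 (periodsT3 F K) c₀ W₂))
    (hN : ∀ (c : J) (φ : SiteL2K ℂ 3 (periodsT3 F K) c₀ W₂) (x : Site (F.P K) 0), (toL2S F K c₀).symm (N₂ c φ) x = χ c x • (toL2S F K c₀).symm φ x) :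
    ∀ y : SiteL2K ℂ 3 (periodsT3 F K) c₀ W₂,
      ∑ c, ‖projR (covLapSite F n K c₀ U₀) Q'' (N₂ c y) - N₂ c (projR (covLapSite F n K c₀ U₀) Q'' y)‖ ^ 2
        ≤ Real.sqrt (2 * (((F.L : ℝ) ^ (K - n)) ^ 2 * ℓf2) * ((8 * (max 2 (16 * c₀ * ((F.L : ℝ) ^ (K - n)) ^ 3 / (a * c₁))) * Real.sqrt ((25 / 8) * (c₁ * ((((F.P K).L : ℝ) ^ (F.P K).d) ^ (K - n))⁻¹ / c₀)) * Real.exp (3 * μ)) ^ 2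
          * (((2 / ((1 + (25 / 8) * (c₁ * ((((F.P K).L : ℝ) ^ (F.P K).d) ^ (K - n))⁻¹ / c₀)) * (600 * (27 / 4 : ℝ) ^ 6 * (c₀ * ((F.L : ℝ) ^ 3) ^ (K - n) / c₁) + a))) ^ 2 / 2 - 3 * ((Real.sqrt (max 2 (16 * c₀ * ((F.L : ℝ) ^ (K - n)) ^ 3 / (a * c₁))) * (2 + Real.sqrt (max 2 (16 * c₀ * ((F.L : ℝ) ^ (K - n)) ^ 3 / (a * c₁))))
          * (Real.sqrt 3 * (eta F n K)⁻¹ * (Real.exp (μ' * eta F n K) - 1) + (Real.sqrt 3 * (eta F n K)⁻¹ * (Real.exp (μ' * eta F n K) - 1)) ^ 2 + Real.sqrt a * (Real.sqrt ((25 / 8) * (c₁ * ((((F.P K).L : ℝ) ^ (F.P K).d) ^ (K - n))⁻¹ / c₀))) * (Real.exp (3 * μ') - 1) + a * (Real.sqrt ((25 / 8) * (c₁ * ((((F.P K).L : ℝ) ^ (F.P K).d) ^ (K - n))⁻¹ / c₀))) ^ 2 * (Real.exp (3 * μ') - 1) ^ 2)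
          * (8 * Real.sqrt (max 2 (16 * c₀ * ((F.L : ℝ) ^ (K - n)) ^ 3 / (a * c₁))) + 8 * Real.sqrt (max 2 (16 * c₀ * ((F.L : ℝ) ^ (K - n)) ^ 3 / (a * c₁))) ^ 2)
          * ((Real.sqrt ((25 / 8) * (c₁ * ((((F.P K).L : ℝ) ^ (F.P K).d) ^ (K - n))⁻¹ / c₀))) * (1 + (Real.exp (3 * μ') - 1))) + (max 2 (16 * c₀ * ((F.L : ℝ) ^ (K - n)) ^ 3 / (a * c₁))) * ((Real.sqrt ((25 / 8) * (c₁ * ((((F.P K).L : ℝ) ^ (F.P K).d) ^ (K - n))⁻¹ / c₀))) * (Real.exp (3 * μ') - 1)))) ^ 2)⁻¹ * Real.exp (9 * μ'))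
          * (4 * (2 * (1 + 1 / (μ - μ'))) ^ 3) ^ 2
          * ((2 / μ') * (2 * (1 + 1 / (μ' / 2))) ^ 3)) ^ 2
            + 8 * ((((F.P K).d : ℝ) * ((F.L : ℝ) ^ (K - n) - 1)) ^ 2 * ℓf2) * ((8 * (max 2 (16 * c₀ * ((F.L : ℝ) ^ (K - n)) ^ 3 / (a * c₁))) * Real.sqrt ((25 / 8) * (c₁ * ((((F.P K).L : ℝ) ^ (F.P K).d) ^ (K - n))⁻¹ / c₀)) * Real.exp (3 * μ)) ^ 2
          * (((2 / ((1 + (25 / 8) * (c₁ * ((((F.P K).L : ℝ) ^ (F.P K).d) ^ (K - n))⁻¹ / c₀)) * (600 * (27 / 4 : ℝ) ^ 6 * (c₀ * ((F.L : ℝ) ^ 3) ^ (K - n) / c₁) + a))) ^ 2 / 2 - 3 * ((Real.sqrt (max 2 (16 * c₀ * ((F.L : ℝ) ^ (K - n)) ^ 3 / (a * c₁))) * (2 + Real.sqrt (max 2 (16 * c₀ * ((F.L : ℝ) ^ (K - n)) ^ 3 / (a * c₁))))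
          * (Real.sqrt 3 * (eta F n K)⁻¹ * (Real.exp (μ' * eta F n K) - 1) + (Real.sqrt 3 * (eta F n K)⁻¹ * (Real.exp (μ' * eta F n K) - 1)) ^ 2 + Real.sqrt a * (Real.sqrt ((25 / 8) * (c₁ * ((((F.P K).L : ℝ) ^ (F.P K).d) ^ (K - n))⁻¹ / c₀))) * (Real.exp (3 * μ') - 1) + a * (Real.sqrt ((25 / 8) * (c₁ * ((((F.P K).L : ℝ) ^ (F.P K).d) ^ (K - n))⁻¹ / c₀))) ^ 2 * (Real.exp (3 * μ') - 1) ^ 2)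
          * (8 * Real.sqrt (max 2 (16 * c₀ * ((F.L : ℝ) ^ (K - n)) ^ 3 / (a * c₁))) + 8 * Real.sqrt (max 2 (16 * c₀ * ((F.L : ℝ) ^ (K - n)) ^ 3 / (a * c₁))) ^ 2)
          * ((Real.sqrt ((25 / 8) * (c₁ * ((((F.P K).L : ℝ) ^ (F.P K).d) ^ (K - n))⁻¹ / c₀))) * (1 + (Real.exp (3 * μ') - 1))) + (max 2 (16 * c₀ * ((F.L : ℝ) ^ (K - n)) ^ 3 / (a * c₁))) * ((Real.sqrt ((25 / 8) * (c₁ * ((((F.P K).L : ℝ) ^ (F.P K).d) ^ (K - n))⁻¹ / c₀))) * (Real.exp (3 * μ') - 1)))) ^ 2)⁻¹ * Real.exp (9 * μ'))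
          * (4 * (2 * (1 + 1 / (μ - μ'))) ^ 3) ^ 2
          * (2 * (1 + 1 / μ')) ^ 3) ^ 2) ^ 2 * ‖y‖ ^ 2 := by
  have hℓf : 0 ≤ ℓf2 :=
    (Finset.sum_nonneg fun c _ => sq_nonneg _).trans (hfam (0 : Site (F.P K) 0) ⟨0, by rw [T3Family.P_d]; omega⟩)
  intro y
  rw [Real.sq_sqrt (by positivity)]
  exact hKP_of_regPr' F hε₀ hε7 U₀ hreg Q'' hseq ha hnK hμ' hμμ' hδ₁ hδ hwin hgap χ hfam N₂ hN y

/-! ## §3 The univ-form step budget from px17's `Zc`-form (the (L6-χ) corner family vanishes off `Zc`) -/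

omit [Fact (0 < c₀)] in
/-- **ADAPTER `Σ_{c ∈ Zc} ↦ Σ_c`**: for a family vanishing off `Zc` (✓`Prop7LODCutoffDock.exists_LOD_cutoffs_corner`, clause `hoff`), the `Zc`-form step budget
`Σ_{c ∈ Zc} (χ_c(x+e_ν) − χ_c x)² ≤ ℓ_f²` gives the univ-form one `Σ_c (χ_c(x+e_ν) − χ_c x)² ≤ ℓ_f²` that §1∕§2 (and ✓`hK3_of_readings`, ✓`sum_re_inner_DeltaEta_cutoffOps_le`) read.
[cite: Balaban1985BackgroundPropagators, (3.100) pp.413–414] -/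
theorem hfam_univ_of_off {Zc : Finset (Site (F.P K) 0)} {χ : Site (F.P K) 0 → Site (F.P K) 0 → ℝ}
    (hoff : ∀ c, c ∉ Zc → ∀ x, χ c x = 0) {ℓf2 : ℝ}
    (hfamZ : ∀ (x : Site (F.P K) 0) (ν : Fin (F.P K).d), ∑ c ∈ Zc, (χ c (x.shift ν) - χ c x) ^ 2 ≤ ℓf2) :
    ∀ (x : Site (F.P K) 0) (ν : Fin (F.P K).d), ∑ c, (χ c (x.shift ν) - χ c x) ^ 2 ≤ ℓf2 := by
  intro x ν
  rw [← Finset.sum_subset (Finset.subset_univ Zc) (fun c _ hc => by rw [hoff c hc, hoff c hc, sub_self, sq, mul_zero])]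
  exact hfamZ x ν

end Summit.QuantumFields.YangMills.Theorems.Prop7LODSlotK2MemberOfRegPr

end
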